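import Literature.NumberTheory.ModularForms.SiegelUnits
import Mathlib.NumberTheory.ModularForms.DedekindEta
import HarnessLib

/-!
# The level-`N` Siegel units as `q`-products over arithmetic progressions, holomorphy, and the
# logarithmic derivative `(log 𝒱_b)′ = 2πi · 12 · G_b`

Topic `Literature/NumberTheory/ModularForms`; namespace `Literature.NumberTheory.ModularForms`.
Sequel of `SiegelUnits`. For `0 < b < N` the unit `𝒱_b(z) = siegelLevel N b z = g_{(b/N,0)}^{12}(Nz)`
is, with `Q = e^{2πiz}` and `r_b = N − 6b + 6b²/N = 6N·B₂(b/N)`,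

  `𝒱_b(z) = e^{2πi r_b z} · (∏_{n ≥ 0} (1 − Q^{Nn+b}) · ∏_{n ≥ 0} (1 − Q^{Nn+N−b}))^{12}`

(`siegelLevel_eq_cexp_mul_progProd`; Kubert–Lang, *Modular Units*, Ch. 2 §1 K4 / Lang,
*Elliptic Functions*, Ch. 19 §2 S1 read at `a = (b/N, 0)`, `τ = Nz`: the exponents `≡ ±b (mod N)`).
We develop the products `P_{a,c}(Q) = ∏_{n≥0}(1 − Q^{an+c})` over an arithmetic progression exactly as
Mathlib develops `∏(1 − Q^{n+1})` for the Dedekind eta function (`Mathlib.NumberTheory.ModularForms.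
DedekindEta`): locally uniform convergence on the unit disc, holomorphy, non-vanishing, and the
logarithmic derivative of `z ↦ P_{a,c}(e^{2πiz})` as the Lambert-type series
`−2πi ∑ (an+c) Q^{an+c}/(1 − Q^{an+c})`. Consequences:

* `mdifferentiable_siegelLevel` — `𝒱_b` is holomorphic on `ℍ` (`N ∤ b`);
* `logDeriv_siegelLevel` — for `0 < b < N` and `Im z > 0`,
  `logDeriv (𝒱_b ∘ ofComplex) z = 2πi · 12 · G_b(z)` with
  `G_b(z) = siegelG N b z = r_b/12 − ∑_{n≥0} (Nn+b)Q^{Nn+b}/(1−Q^{Nn+b}) − ∑_{n≥0} (Nn+N−b)Q^{Nn+N−b}/(1−Q^{Nn+N−b})`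
  (`r_b/12 = (N/2)B₂(b/N)`), the weight-`2` Eisenstein-type series whose character sums are
  `−2E₂^{𝟙,ψ}` (next file).

Everything is proved; no named facts.

## References

* [KubertLang1981] D. S. Kubert, S. Lang, *Modular Units*, Grundlehren 244 (1981), Ch. 2 §1 (K4),
  Ch. 4 §1.
* [Lang1987] S. Lang, *Elliptic Functions*, 2nd ed., GTM 112 (1987), Ch. 19 §2 (S1), Ch. 18 §5
  (`q`-expansion of `Δ`).
* [DiamondShurman2005] F. Diamond, J. Shurman, *A First Course in Modular Forms*, GTM 228 (2005),
  §1.2 (logarithmic derivative of `η`), §4.8 (Eisenstein series of weight `2` via units).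
-/

noncomputable section

open Complex Set Function Filter
open UpperHalfPlane hiding I
open scoped Real Topology MatrixGroups Manifold

namespace Literature.NumberTheory.ModularForms

local notation "𝕢" => Periodic.qParam
local notation "ℍₒ" => upperHalfPlaneSet

/-! ### Products over an arithmetic progression of exponents -/

/-- `P_{a,c}(Q) = ∏_{n ≥ 0} (1 − Q^{an+c})`. [folklore] -/
def progProd (a c : ℕ) (Q : ℂ) : ℂ := ∏' n : ℕ, (1 - Q ^ (a * n + c))

/-- Unfolding lemma. [folklore] -/
theorem progProd_def (a c : ℕ) (Q : ℂ) : progProd a c Q = ∏' n : ℕ, (1 - Q ^ (a * n + c)) := rfl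

section Prog

variable {a c : ℕ}

/-- `‖Q^{an+c}‖ ≤ ‖Q‖^{n+c}` for `‖Q‖ ≤ 1`, `a ≥ 1`. [folklore] -/
theorem norm_pow_prog_le {Q : ℂ} (hQ : ‖Q‖ ≤ 1) (ha : 1 ≤ a) (n : ℕ) :
    ‖Q ^ (a * n + c)‖ ≤ ‖Q‖ ^ (n + c) := by
  rw [norm_pow]
  exact pow_le_pow_of_le_one (norm_nonneg _) hQ (by nlinarith)

/-- `∑ ‖Q^{an+c}‖ < ∞` for `‖Q‖ < 1`, `a ≥ 1`. [folklore] -/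
theorem summable_norm_pow_prog {Q : ℂ} (hQ : ‖Q‖ < 1) (ha : 1 ≤ a) :
    Summable fun n : ℕ ↦ ‖-Q ^ (a * n + c)‖ := by
  refine Summable.of_nonneg_of_le (fun n ↦ norm_nonneg _) (fun n ↦ ?_)
    ((summable_nat_add_iff c).mpr (summable_geometric_of_lt_one (norm_nonneg _) hQ))
  rw [norm_neg]
  exact norm_pow_prog_le hQ.le ha n

/-- `1 − Q^{an+c} ≠ 0` for `‖Q‖ < 1`, `c ≥ 1`. [folklore] -/
theorem one_sub_pow_prog_ne_zero {Q : ℂ} (hQ : ‖Q‖ < 1) (hc : 1 ≤ c) (n : ℕ) :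
    (1 : ℂ) - Q ^ (a * n + c) ≠ 0 := by
  refine sub_ne_zero.mpr (Ne.symm fun h ↦ ?_)
  have hlt : ‖Q ^ (a * n + c)‖ < 1 := by
    rw [norm_pow]; exact pow_lt_one₀ (norm_nonneg _) hQ (by omega)
  rw [h, norm_one] at hlt
  exact lt_irrefl _ hlt

/-- `P_{a,c}(Q)` converges for `‖Q‖ < 1`, `a ≥ 1`. [folklore] -/
theorem multipliable_progProd {Q : ℂ} (hQ : ‖Q‖ < 1) (ha : 1 ≤ a) :
    Multipliable fun n : ℕ ↦ 1 - Q ^ (a * n + c) := by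
  simpa [sub_eq_add_neg] using multipliable_one_add_of_summable (summable_norm_pow_prog hQ ha)

/-- `P_{a,c}(Q) ≠ 0` for `‖Q‖ < 1`, `a, c ≥ 1`. [folklore] -/
theorem progProd_ne_zero {Q : ℂ} (hQ : ‖Q‖ < 1) (ha : 1 ≤ a) (hc : 1 ≤ c) : progProd a c Q ≠ 0 := by
  have h := tprod_one_add_ne_zero_of_summable (f := fun n : ℕ ↦ -Q ^ (a * n + c))
    (fun n ↦ by simpa [← sub_eq_add_neg] using one_sub_pow_prog_ne_zero hQ hc n)
    (summable_norm_pow_prog hQ ha)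
  simpa [progProd_def, sub_eq_add_neg] using h

/-- **Locally uniform convergence of `P_{a,c}` on the unit disc** (as Mathlib's
`multipliableLocallyUniformlyOn_one_sub_pow`). [folklore] -/
theorem multipliableLocallyUniformlyOn_progProd (ha : 1 ≤ a) (c : ℕ) :
    MultipliableLocallyUniformlyOn (fun n Q ↦ 1 - Q ^ (a * n + c)) (Metric.ball (0 : ℂ) 1) := by
  use fun Q ↦ ∏' n, (1 - Q ^ (a * n + c))
  simp_rw [sub_eq_add_neg]
  apply hasProdLocallyUniformlyOn_of_forall_compact Metric.isOpen_ball
  intro K hK hcK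
  rcases K.eq_empty_or_nonempty with hN | hN
  · simpa [hasProdUniformlyOn_iff_tendstoUniformlyOn, hN] using tendstoUniformlyOn_empty
  · obtain ⟨q₀, hq₀, _, HB⟩ := hcK.exists_sSup_image_eq_and_ge hN
      (show ContinuousOn (fun q : ℂ ↦ ‖q‖) K by fun_prop)
    have hq1 : ‖q₀‖ < 1 := by simpa [Metric.mem_ball, dist_zero_right] using hK hq₀
    refine ((summable_nat_add_iff c).mpr (summable_geometric_of_lt_one (norm_nonneg _)
      hq1)).hasProdUniformlyOn_nat_one_add hcK (.of_forall fun n x hx ↦ ?_) (fun _ ↦ by fun_prop)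
    rw [norm_neg]
    have hx1 : ‖x‖ ≤ 1 :=
      (by simpa [Metric.mem_ball, dist_zero_right] using hK hx : ‖x‖ < 1).le
    exact (norm_pow_prog_le hx1 ha n).trans (pow_le_pow_left₀ (norm_nonneg _) (HB x hx) _)

/-- `P_{a,c}` is holomorphic on the unit disc. [folklore] -/
theorem differentiableOn_progProd (ha : 1 ≤ a) (c : ℕ) :
    DifferentiableOn ℂ (progProd a c) (Metric.ball (0 : ℂ) 1) := by
  have h := (multipliableLocallyUniformlyOn_progProd ha c).hasProdLocallyUniformlyOn.differentiableOn
    (.of_forall fun _ ↦ by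
      simpa [Finset.prod_fn] using DifferentiableOn.finsetProd (fun _ _ ↦ by fun_prop))
    Metric.isOpen_ball
  exact h.congr fun Q hQ ↦ (multipliableLocallyUniformlyOn_progProd ha c).hasProdLocallyUniformlyOn
    |>.hasProd hQ |>.tprod_eq

/-- `𝕢 1` maps `ℍₒ` into the unit disc. [folklore] -/
theorem qParam_mem_ball {z : ℂ} (hz : z ∈ ℍₒ) : 𝕢 1 z ∈ Metric.ball (0 : ℂ) 1 := by
  simpa using Periodic.norm_qParam_lt_one one_pos (z := z) hz

/-- `‖𝕢 1 z‖ < 1` on `ℍₒ`. [folklore] -/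
theorem norm_qParam_lt_one' {z : ℂ} (hz : z ∈ ℍₒ) : ‖𝕢 1 z‖ < 1 :=
  Periodic.norm_qParam_lt_one one_pos (z := z) hz

/-- Locally uniform convergence of `z ↦ P_{a,c}(e^{2πiz})` on `ℍₒ`. [folklore] -/
theorem multipliableLocallyUniformlyOn_progProd_comp (ha : 1 ≤ a) (c : ℕ) :
    MultipliableLocallyUniformlyOn (fun n z ↦ 1 - (𝕢 1 z) ^ (a * n + c)) ℍₒ :=
  (multipliableLocallyUniformlyOn_progProd ha c).comp (𝕢 1) (fun _ hz ↦ qParam_mem_ball hz)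
    (by fun_prop)

/-- `z ↦ P_{a,c}(e^{2πiz})` is differentiable on `ℍₒ`. [folklore] -/
theorem differentiableAt_progProd_comp (ha : 1 ≤ a) (c : ℕ) {z : ℂ} (hz : z ∈ ℍₒ) :
    DifferentiableAt ℂ (fun x ↦ progProd a c (𝕢 1 x)) z :=
  ((differentiableOn_progProd ha c).differentiableAt (Metric.isOpen_ball.mem_nhds
    (qParam_mem_ball hz))).comp z (by fun_prop)

/-- The factor `1 − Q^{an+c}` as `(1 − e^w) ∘ (w = 2πi(an+c)z)`. [folklore] -/
theorem one_sub_qParam_pow_eq (a c n : ℕ) :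
    (fun z : ℂ ↦ 1 - (𝕢 1 z) ^ (a * n + c)) =
      (fun w ↦ 1 - 1 * cexp w) ∘ fun z ↦ 2 * π * I * (a * n + c) * z := by
  ext z
  simp only [Function.comp_apply, one_mul, Periodic.qParam, ← Complex.exp_nat_mul]
  congr 2
  push_cast
  ring

/-- `logDeriv (1 − Q^{m}) = −2πi m Q^m/(1 − Q^m)` (`m = an + c`, `Q = e^{2πiz}`). [folklore] -/
theorem logDeriv_one_sub_qParam_pow (a c n : ℕ) (z : ℂ) :
    logDeriv (fun z : ℂ ↦ 1 - (𝕢 1 z) ^ (a * n + c)) z =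
      -(2 * π * I * (a * n + c)) * (𝕢 1 z) ^ (a * n + c) / (1 - (𝕢 1 z) ^ (a * n + c)) := by
  rw [one_sub_qParam_pow_eq, ModularForm.logDeriv_one_sub_mul_cexp_comp 1 (by fun_prop)]
  simp only [deriv_const_mul_id, one_mul]
  have hq : (𝕢 1 z) ^ (a * n + c) = cexp (2 * π * I * (a * n + c) * z) := by
    simp only [Periodic.qParam, ← Complex.exp_nat_mul]
    congr 1; push_cast; ring
  rw [hq]
  ring

/-- Summability of the logarithmic derivatives of the factors. [folklore] -/
theorem summable_logDeriv_one_sub_qParam_pow (ha : 1 ≤ a) (c : ℕ) {z : ℂ} (hz : z ∈ ℍₒ) :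
    Summable fun n : ℕ ↦ logDeriv (fun x : ℂ ↦ 1 - (𝕢 1 x) ^ (a * n + c)) z := by
  have hq := norm_qParam_lt_one' hz
  -- subfamily of the summable `m ↦ m Q^m/(1 − Q^m)`
  have hS : Summable fun m : ℕ ↦ (m : ℂ) ^ 1 * (𝕢 1 z) ^ m / (1 - (𝕢 1 z) ^ m) :=
    summable_norm_pow_mul_geometric_div_one_sub 1 hq
  have hinj : Function.Injective fun n : ℕ ↦ a * n + c := fun m n h ↦ by
    dsimp only at h
    have : a * m = a * n := by omega
    exact Nat.eq_of_mul_eq_mul_left (by omega) this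
  have h2 := (hS.comp_injective hinj).mul_left (-(2 * π * I))
  refine h2.congr fun n ↦ ?_
  rw [logDeriv_one_sub_qParam_pow]
  simp only [Function.comp_apply, pow_one]
  push_cast
  ring

/-- **The logarithmic derivative of `z ↦ P_{a,c}(e^{2πiz})`**:
`−2πi ∑_{n ≥ 0} (an+c) Q^{an+c}/(1 − Q^{an+c})`. [cite: DiamondShurman2005, §1.2] -/
theorem logDeriv_progProd_comp (ha : 1 ≤ a) (hc : 1 ≤ c) {z : ℂ} (hz : z ∈ ℍₒ) :
    logDeriv (fun x ↦ progProd a c (𝕢 1 x)) z =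
      -(2 * π * I) * ∑' n : ℕ, ((a * n + c : ℕ) : ℂ) * (𝕢 1 z) ^ (a * n + c) /
        (1 - (𝕢 1 z) ^ (a * n + c)) := by
  have hq := norm_qParam_lt_one' hz
  have hne : ∀ n : ℕ, (1 : ℂ) - (𝕢 1 z) ^ (a * n + c) ≠ 0 := one_sub_pow_prog_ne_zero hq hc
  have HG := logDeriv_tprod_eq_tsum isOpen_upperHalfPlaneSet hz
    (f := fun n x ↦ 1 - (𝕢 1 x) ^ (a * n + c)) hne (fun n ↦ by fun_prop)
    (summable_logDeriv_one_sub_qParam_pow ha c hz) (multipliableLocallyUniformlyOn_progProd_comp ha c)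
    (progProd_ne_zero hq ha hc)
  have hfun : (fun x ↦ progProd a c (𝕢 1 x)) = fun x ↦ ∏' n : ℕ, (1 - (𝕢 1 x) ^ (a * n + c)) := rfl
  rw [hfun, HG, tsum_congr (fun n ↦ logDeriv_one_sub_qParam_pow a c n z), ← tsum_mul_left]
  refine tsum_congr fun n ↦ ?_
  push_cast
  ring

end Prog

/-! ### The level-`N` units as products over the progressions `≡ ±b (mod N)` -/

section Level

variable {N : ℕ}

/-- The exponent `r_b = N − 6b + 6b²/N = 6N·B₂(b/N)` of the leading factor `e^{2πi r_b z}` of `𝒱_b`.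
[cite: KubertLang1981, Ch. 2 §1, K4] -/
def siegelR (N b : ℕ) : ℂ := (N : ℂ) - 6 * b + 6 * (b : ℂ) ^ 2 / N

/-- Unfolding lemma. [folklore] -/
theorem siegelR_def (N b : ℕ) : siegelR N b = (N : ℂ) - 6 * b + 6 * (b : ℂ) ^ 2 / N := rfl

/-- `Nn + (N − b) = N(n+1) − b` for `b ≤ N`. [folklore] -/
theorem prog_exponent_eq {b : ℕ} (hbN : b ≤ N) (n : ℕ) : N * n + (N - b) = N * (n + 1) - b := by
  rw [Nat.mul_succ]; omega

/-- **`𝒱_b` as a product over the two progressions**: for `0 < b < N` and `Q = e^{2πiz}`,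
`siegelLevel N b z = e^{2πi r_b z} (P_{N,b}(Q) · P_{N,N−b}(Q))^{12}`, i.e.
`g_{(b/N,0)}^{12}(Nz) = e^{2πir_bz}∏_{m ≥ 1, m ≡ ±b (N)}(1 − Q^m)^{12}` (S1 at `a = (b/N, 0)`,
`τ = Nz`). [cite: KubertLang1981, Ch. 2 §1, K4] [cite: Lang1987, Ch. 19 §2, S1] -/
theorem siegelLevel_eq_cexp_mul_progProd [NeZero N] {b : ℕ} (hbN : b < N) (z : ℍ) :
    siegelLevel N b z =
      cexp (2 * π * I * siegelR N b * z) * (progProd N b (𝕢 1 z) * progProd N (N - b) (𝕢 1 z)) ^ 12 := by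
  have hN : (N : ℂ) ≠ 0 := Nat.cast_ne_zero.mpr (NeZero.ne N)
  have hN1 : 1 ≤ N := NeZero.one_le
  have hQ : 𝕢 1 (z : ℂ) = cexp (2 * π * I * z) := by simp [Periodic.qParam]
  have hQ1 : ‖𝕢 1 (z : ℂ)‖ < 1 := norm_qParam_lt_one' z.2
  have hQ0 : 𝕢 1 (z : ℂ) ≠ 0 := by rw [hQ]; exact exp_ne_zero _
  -- the ingredients of S1 at `a = (b/N, 0)`, `τ = Nz`
  have hT : ((mulNat N z : ℍ) : ℂ) = N * z := coe_mulNat N z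
  have ha0 : ((((![(b : ℝ) / N, 0] : Fin 2 → ℝ) 0 : ℝ) : ℂ)) = (b : ℂ) / N := by simp
  have ha1 : ((((![(b : ℝ) / N, 0] : Fin 2 → ℝ) 1 : ℝ) : ℂ)) = 0 := by simp
  have hw : (((![(b : ℝ) / N, 0] : Fin 2 → ℝ) 0 : ℝ) : ℂ) * ((mulNat N z : ℍ) : ℂ) +
      (((![(b : ℝ) / N, 0] : Fin 2 → ℝ) 1 : ℝ) : ℂ) = b * z := by
    rw [ha0, ha1, hT, add_zero]; field_simp
  have h1 : cexp (2 * π * I * ((mulNat N z : ℍ) : ℂ)) = 𝕢 1 (z : ℂ) ^ N := by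
    rw [hT, hQ, ← Complex.exp_nat_mul]; ring_nf
  have h2 : cexp (2 * π * I * ((b : ℂ) * z)) = 𝕢 1 (z : ℂ) ^ b := by
    rw [hQ, ← Complex.exp_nat_mul]; ring_nf
  have h3 : ∀ n : ℕ, (𝕢 1 (z : ℂ) ^ N) ^ (n + 1) * 𝕢 1 (z : ℂ) ^ b =
      𝕢 1 (z : ℂ) ^ (N * (n + 1) + b) := fun n ↦ by rw [← pow_mul, ← pow_add]
  have h4 : ∀ n : ℕ, (𝕢 1 (z : ℂ) ^ N) ^ (n + 1) * (𝕢 1 (z : ℂ) ^ b)⁻¹ =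
      𝕢 1 (z : ℂ) ^ (N * (n + 1) - b) := fun n ↦ by
    rw [← pow_mul, pow_sub₀ _ hQ0 (by nlinarith)]
  have h8 : 𝕢 1 (z : ℂ) ^ N * cexp (12 * (π * I * ((b : ℂ) / N - 1) * ((b : ℂ) * z))) =
      cexp (2 * π * I * siegelR N b * z) := by
    rw [hQ, ← Complex.exp_nat_mul, ← Complex.exp_add]
    have hexp : (N : ℂ) * (2 * π * I * z) + 12 * (π * I * ((b : ℂ) / N - 1) * ((b : ℂ) * z)) =
        2 * π * I * siegelR N b * z := by
      rw [siegelR_def]; field_simp; ring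
    rw [hexp]
  -- the two progressions
  have hm1 : Multipliable fun n : ℕ ↦ 1 - 𝕢 1 (z : ℂ) ^ (N * (n + 1) + b) :=
    (multipliable_progProd (c := N + b) hQ1 hN1).congr fun n ↦ by ring_nf
  have hm2 : Multipliable fun n : ℕ ↦ 1 - 𝕢 1 (z : ℂ) ^ (N * (n + 1) - b) :=
    (multipliable_progProd (c := N - b) hQ1 hN1).congr fun n ↦ by rw [prog_exponent_eq hbN.le]
  have h5 : progProd N b (𝕢 1 z) = (1 - 𝕢 1 (z : ℂ) ^ b) * ∏' n : ℕ, (1 - 𝕢 1 (z : ℂ) ^ (N * (n + 1) + b)) := by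
    rw [progProd_def, tprod_eq_zero_mul' (f := fun n ↦ 1 - 𝕢 1 (z : ℂ) ^ (N * n + b)) hm1]
    simp only [Nat.mul_zero, zero_add]
  have h6 : progProd N (N - b) (𝕢 1 z) = ∏' n : ℕ, (1 - 𝕢 1 (z : ℂ) ^ (N * (n + 1) - b)) := by
    rw [progProd_def]
    exact tprod_congr fun n ↦ by rw [prog_exponent_eq hbN.le]
  have h7 : (∏' n : ℕ, (1 - 𝕢 1 (z : ℂ) ^ (N * (n + 1) + b)) * (1 - 𝕢 1 (z : ℂ) ^ (N * (n + 1) - b))) =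
      (∏' n : ℕ, (1 - 𝕢 1 (z : ℂ) ^ (N * (n + 1) + b))) *
        ∏' n : ℕ, (1 - 𝕢 1 (z : ℂ) ^ (N * (n + 1) - b)) := hm1.tprod_mul hm2
  rw [siegelLevel_def, Int.cast_natCast, siegelPow_eq_qProduct, hw, ha0, h1, h2]
  simp_rw [h3, h4]
  rw [h7, h5, h6, ← h8]
  ring

/-- The holomorphic model `f_b(x) = e^{2πi r_b x} (P_{N,b}(e^{2πix}) P_{N,N−b}(e^{2πix}))^{12}` of
`𝒱_b` on `ℂ`. [folklore] -/
def siegelLevelC (N : ℕ) (b : ℕ) (x : ℂ) : ℂ :=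
  cexp (2 * π * I * siegelR N b * x) * (progProd N b (𝕢 1 x) * progProd N (N - b) (𝕢 1 x)) ^ 12

/-- Unfolding lemma. [folklore] -/
theorem siegelLevelC_def (N b : ℕ) (x : ℂ) : siegelLevelC N b x =
    cexp (2 * π * I * siegelR N b * x) * (progProd N b (𝕢 1 x) * progProd N (N - b) (𝕢 1 x)) ^ 12 :=
  rfl

/-- `𝒱_b ∘ ofComplex = f_b` on `ℍₒ`. [folklore] -/
theorem siegelLevel_ofComplex [NeZero N] {b : ℕ} (hbN : b < N) {x : ℂ} (hx : x ∈ ℍₒ) :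
    siegelLevel N b (ofComplex x) = siegelLevelC N b x := by
  rw [siegelLevel_eq_cexp_mul_progProd hbN, siegelLevelC_def, ofComplex_apply_of_im_pos hx]

/-- `f_b` is differentiable on `ℍₒ`. [folklore] -/
theorem differentiableAt_siegelLevelC [NeZero N] (b : ℕ) {x : ℂ} (hx : x ∈ ℍₒ) :
    DifferentiableAt ℂ (siegelLevelC N b) x := by
  have hN1 : 1 ≤ N := NeZero.one_le
  have h1 := differentiableAt_progProd_comp hN1 b hx
  have h2 := differentiableAt_progProd_comp hN1 (N - b) hx
  unfold siegelLevelC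
  fun_prop

/-- **`𝒱_b` is holomorphic on `ℍ`** (`0 < b < N`). [cite: Lang1987, Ch. 19 §2, Thm. 2] -/
theorem mdifferentiable_siegelLevel_nat [NeZero N] {b : ℕ} (hbN : b < N) :
    MDiff (siegelLevel N (b : ℤ)) := by
  rw [UpperHalfPlane.mdifferentiable_iff]
  refine DifferentiableOn.congr (f := siegelLevelC N b) (fun x hx ↦
    (differentiableAt_siegelLevelC b hx).differentiableWithinAt) fun x hx ↦ ?_
  exact siegelLevel_ofComplex hbN hx

/-- Reduction of `b ∈ ℤ` to its residue `b mod N ∈ [0, N)`. [folklore] -/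
theorem siegelLevel_eq_siegelLevel_toNat_emod [NeZero N] (b : ℤ) (z : ℍ) :
    siegelLevel N b z = siegelLevel N (((b % (N : ℤ)).toNat : ℕ) : ℤ) z := by
  have hN : (0 : ℤ) < N := Int.natCast_pos.mpr (NeZero.pos N)
  have h0 : 0 ≤ b % (N : ℤ) := Int.emod_nonneg _ hN.ne'
  rw [Int.toNat_of_nonneg h0]
  exact siegelLevel_congr N (Int.mod_modEq b N).symm z

/-- The residue `(b mod N).toNat` lies in `[0, N)`, and is positive when `N ∤ b`. [folklore] -/
theorem toNat_emod_lt [NeZero N] (b : ℤ) : (b % (N : ℤ)).toNat < N := by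
  have hN : (0 : ℤ) < N := Int.natCast_pos.mpr (NeZero.pos N)
  have h := Int.emod_lt_of_pos b hN
  have h0 : 0 ≤ b % (N : ℤ) := Int.emod_nonneg _ hN.ne'
  omega

/-- Positivity of the residue when `N ∤ b`. [folklore] -/
theorem toNat_emod_pos [NeZero N] {b : ℤ} (hb : ¬ (N : ℤ) ∣ b) : 0 < (b % (N : ℤ)).toNat := by
  have hN : (0 : ℤ) < N := Int.natCast_pos.mpr (NeZero.pos N)
  have h0 : 0 ≤ b % (N : ℤ) := Int.emod_nonneg _ hN.ne'
  have hne : b % (N : ℤ) ≠ 0 := fun h ↦ hb (Int.dvd_of_emod_eq_zero h)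
  omega

/-- **`𝒱_b` is holomorphic on `ℍ`** for every `b ∈ ℤ` with `N ∤ b`. [cite: Lang1987, Ch. 19 §2, Thm. 2] -/
theorem mdifferentiable_siegelLevel [NeZero N] {b : ℤ} (hb : ¬ (N : ℤ) ∣ b) :
    MDiff (siegelLevel N b) := by
  have hfun : siegelLevel N b = siegelLevel N (((b % (N : ℤ)).toNat : ℕ) : ℤ) :=
    funext fun z ↦ siegelLevel_eq_siegelLevel_toNat_emod b z
  have _ := toNat_emod_pos hb
  rw [hfun]
  exact mdifferentiable_siegelLevel_nat (toNat_emod_lt b)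

/-- **`𝒱_b` is continuous on `ℍ`** (`N ∤ b`). [folklore] -/
theorem continuous_siegelLevel [NeZero N] {b : ℤ} (hb : ¬ (N : ℤ) ∣ b) :
    Continuous (siegelLevel N b) :=
  (mdifferentiable_siegelLevel hb).continuous

/-! ### The logarithmic derivative -/

/-- The weight-`2` Eisenstein-type series attached to the residue `b mod N`:
`G_b(z) = r_b/12 − ∑_{n≥0} (Nn+b)Q^{Nn+b}/(1−Q^{Nn+b}) − ∑_{n≥0} (Nn+N−b)Q^{Nn+N−b}/(1−Q^{Nn+N−b})`,
`Q = e^{2πiz}` (`r_b/12 = (N/2)B₂(b/N)`; for `0 < b < N` the two sums run over the positive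
`m ≡ b` and `m ≡ −b (mod N)`). [cite: DiamondShurman2005, §4.8] -/
def siegelG (N : ℕ) (b : ℕ) (z : ℂ) : ℂ :=
  siegelR N b / 12 -
    ∑' n : ℕ, ((N * n + b : ℕ) : ℂ) * (𝕢 1 z) ^ (N * n + b) / (1 - (𝕢 1 z) ^ (N * n + b)) -
    ∑' n : ℕ, ((N * n + (N - b) : ℕ) : ℂ) * (𝕢 1 z) ^ (N * n + (N - b)) /
      (1 - (𝕢 1 z) ^ (N * n + (N - b)))

/-- Unfolding lemma. [folklore] -/
theorem siegelG_def (N b : ℕ) (z : ℂ) : siegelG N b z = siegelR N b / 12 -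
    ∑' n : ℕ, ((N * n + b : ℕ) : ℂ) * (𝕢 1 z) ^ (N * n + b) / (1 - (𝕢 1 z) ^ (N * n + b)) -
    ∑' n : ℕ, ((N * n + (N - b) : ℕ) : ℂ) * (𝕢 1 z) ^ (N * n + (N - b)) /
      (1 - (𝕢 1 z) ^ (N * n + (N - b))) := rfl

/-- `logDeriv (x ↦ e^{cx}) = c`. [folklore] -/
theorem logDeriv_cexp_const_mul (c x : ℂ) : logDeriv (fun y ↦ cexp (c * y)) x = c := by
  have hd : HasDerivAt (fun y ↦ cexp (c * y)) (cexp (c * x) * (c * 1)) x :=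
    ((hasDerivAt_id x).const_mul c).cexp
  rw [logDeriv_apply, hd.deriv]
  field_simp [Complex.exp_ne_zero]

/-- **The logarithmic derivative of `f_b`**: `logDeriv f_b = 2πi · 12 · G_b` on `ℍₒ` (`0 < b < N`).
[cite: DiamondShurman2005, §1.2 and §4.8] -/
theorem logDeriv_siegelLevelC [NeZero N] {b : ℕ} (hb0 : 0 < b) (hbN : b < N) {x : ℂ}
    (hx : x ∈ ℍₒ) : logDeriv (siegelLevelC N b) x = 2 * π * I * 12 * siegelG N b x := by
  have hN1 : 1 ≤ N := NeZero.one_le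
  have hQ1 : ‖𝕢 1 x‖ < 1 := norm_qParam_lt_one' hx
  have hE : cexp (2 * π * I * siegelR N b * x) ≠ 0 := exp_ne_zero _
  have hP1 : progProd N b (𝕢 1 x) ≠ 0 := progProd_ne_zero hQ1 hN1 hb0
  have hP2 : progProd N (N - b) (𝕢 1 x) ≠ 0 := progProd_ne_zero hQ1 hN1 (by omega)
  have hd1 := differentiableAt_progProd_comp hN1 b hx
  have hd2 := differentiableAt_progProd_comp hN1 (N - b) hx
  have hdE : DifferentiableAt ℂ (fun y ↦ cexp (2 * π * I * siegelR N b * y)) x := by fun_prop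
  have hdP : DifferentiableAt ℂ (fun y ↦ progProd N b (𝕢 1 y) * progProd N (N - b) (𝕢 1 y)) x :=
    hd1.mul hd2
  have hpow : (progProd N b (𝕢 1 x) * progProd N (N - b) (𝕢 1 x)) ^ 12 ≠ 0 :=
    pow_ne_zero _ (mul_ne_zero hP1 hP2)
  have key : logDeriv (siegelLevelC N b) x =
      logDeriv (fun y ↦ cexp (2 * π * I * siegelR N b * y)) x +
        logDeriv (fun y ↦ (progProd N b (𝕢 1 y) * progProd N (N - b) (𝕢 1 y)) ^ 12) x :=
    logDeriv_mul (f := fun y ↦ cexp (2 * π * I * siegelR N b * y))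
      (g := fun y ↦ (progProd N b (𝕢 1 y) * progProd N (N - b) (𝕢 1 y)) ^ 12) x hE hpow hdE
      (hdP.pow 12)
  have key2 : logDeriv (fun y ↦ (progProd N b (𝕢 1 y) * progProd N (N - b) (𝕢 1 y)) ^ 12) x =
      ((12 : ℕ) : ℂ) * logDeriv (fun y ↦ progProd N b (𝕢 1 y) * progProd N (N - b) (𝕢 1 y)) x :=
    logDeriv_fun_pow hdP 12
  have key3 : logDeriv (fun y ↦ progProd N b (𝕢 1 y) * progProd N (N - b) (𝕢 1 y)) x =
      logDeriv (fun y ↦ progProd N b (𝕢 1 y)) x + logDeriv (fun y ↦ progProd N (N - b) (𝕢 1 y)) x :=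
    logDeriv_mul (f := fun y ↦ progProd N b (𝕢 1 y)) (g := fun y ↦ progProd N (N - b) (𝕢 1 y)) x
      hP1 hP2 hd1 hd2
  rw [key, logDeriv_cexp_const_mul, key2, key3, logDeriv_progProd_comp hN1 hb0 hx,
    logDeriv_progProd_comp hN1 (by omega) hx, siegelG_def]
  push_cast
  ring

/-- **`(log 𝒱_b)′ = 2πi · 12 · G_b`**: the logarithmic derivative of `𝒱_b ∘ ofComplex` at a point of
`ℍₒ` (`0 < b < N`). [cite: DiamondShurman2005, §4.8] -/
theorem logDeriv_siegelLevel [NeZero N] {b : ℕ} (hb0 : 0 < b) (hbN : b < N) {x : ℂ} (hx : x ∈ ℍₒ) :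
    logDeriv (fun y ↦ siegelLevel N b (ofComplex y)) x = 2 * π * I * 12 * siegelG N b x := by
  have heq : (fun y ↦ siegelLevel N b (ofComplex y)) =ᶠ[𝓝 x] siegelLevelC N b := by
    filter_upwards [isOpen_upperHalfPlaneSet.mem_nhds hx] with y hy
    exact siegelLevel_ofComplex hbN hy
  rw [logDeriv_apply, heq.deriv_eq, heq.eq_of_nhds, ← logDeriv_apply, logDeriv_siegelLevelC hb0 hbN hx]

end Level

end Literature.NumberTheory.ModularForms

end
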